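import Literature.Analysis.FluidPDE.PassiveVectorTensorPropagatorEnergy
import HarnessLib

/-!
# K1L_D (stmt-AnomalousDissipation-27980), brick Z1′ support: the REAL gradient series of a field with finite `eGradNormSq` and the time-integrability
# of the dissipation density of a weak tensor solution (helper; `--supports … --as helper`; lead-k1l-onelevel-p1 g3)

The domination step of the two-problem duality (brick Z1′, `Lines/onelevel_Z_bricks.lean`; cross bounds …TwoProblemCross) is phrased with the REAL
series `Σ_k |k|² ‖𝓕(v)(k)‖²`; the tree's weak classes carry the `ℝ≥0∞` quantity `eGradNormSq v = 4π² Σ_k |k|² ‖𝓕(v)(k)‖ₑ²`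
(`eGradNormSq_eq_tsum`) and its finiteness in time-integral (`eVectorDissipation_lt_top`).  THIS FILE converts: (1) if `eGradNormSq v ≠ ⊤` the real
series is summable and `Σ_k |k|²‖𝓕v(k)‖² = (eGradNormSq v).toReal / (4π²)` (`summable_freqNormSq_mul_sq`, `tsum_freqNormSq_mul_sq_eq`); (2) for a weak
tensor passive-vector solution with finite dissipation the density `s ↦ (eGradNormSq (w s)).toReal` is integrable on `(0,T)` and the set where
`eGradNormSq (w s) = ⊤` is null (`integrableOn_toReal_eGradNormSq`, `ae_eGradNormSq_ne_top`).  NOT a proof of Z1′, of the crux, or of AD; rung F-D1.A0.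
-/

set_option linter.dupNamespace false

noncomputable section

namespace Summit.AnomalousDissipation.AnomalousDissipation.Theorems.SolenoidalFractalHomogenisation.LagrangianStep

open Literature.Analysis Literature.Analysis.FluidPDE Literature.Analysis.FluidPDE.Torus Literature.Analysis.FunctionSpaces
open MeasureTheory Set Filter UnitAddTorus
open scoped ENNReal NNReal InnerProductSpace

variable {d : Type*} [Fintype d] [DecidableEq d]

omit [DecidableEq d] in
/-- The terms of `eGradNormSq_eq_tsum` in real form. -/
theorem toReal_term_eq (v : UnitAddTorus d → EuclideanSpace ℝ d) (k : d → ℤ) :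
    (ENNReal.ofReal (Torus.freqNormSq k) * ‖mFourierCoeff (EuclideanSpace.complexify ∘ v) k‖ₑ ^ 2).toReal
      = Torus.freqNormSq k * ‖mFourierCoeff (EuclideanSpace.complexify ∘ v) k‖ ^ 2 := by
  rw [ENNReal.toReal_mul, ENNReal.toReal_ofReal (Torus.freqNormSq_nonneg k), ENNReal.toReal_pow, toReal_enorm]

omit [DecidableEq d] in
/-- **Finite spectral gradient ⇒ summable real gradient series**, with `Σ_k |k|²‖𝓕v(k)‖² = (eGradNormSq v).toReal / (4π²)`. -/
theorem summable_freqNormSq_mul_sq (v : UnitAddTorus d → EuclideanSpace ℝ d) (h : Torus.eGradNormSq v ≠ ⊤) :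
    Summable (fun k : d → ℤ => Torus.freqNormSq k * ‖mFourierCoeff (EuclideanSpace.complexify ∘ v) k‖ ^ 2) ∧
      ∑' k : d → ℤ, Torus.freqNormSq k * ‖mFourierCoeff (EuclideanSpace.complexify ∘ v) k‖ ^ 2
        = (Torus.eGradNormSq v).toReal / (4 * Real.pi ^ 2) := by
  have hpi : ENNReal.ofReal (4 * Real.pi ^ 2) ≠ 0 := by
    rw [Ne, ENNReal.ofReal_eq_zero, not_le]; positivity
  have hS : ∑' k : d → ℤ, ENNReal.ofReal (Torus.freqNormSq k) * ‖mFourierCoeff (EuclideanSpace.complexify ∘ v) k‖ₑ ^ 2 ≠ ⊤ := by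
    intro htop
    apply h
    rw [Torus.eGradNormSq_eq_tsum, htop, ENNReal.mul_top hpi]
  have hterm : ∀ k : d → ℤ, ENNReal.ofReal (Torus.freqNormSq k) * ‖mFourierCoeff (EuclideanSpace.complexify ∘ v) k‖ₑ ^ 2 ≠ ⊤ :=
    fun k => ENNReal.mul_ne_top ENNReal.ofReal_ne_top (ENNReal.pow_ne_top enorm_ne_top)
  have hsum := ENNReal.summable_toReal hS
  simp only [toReal_term_eq] at hsum
  refine ⟨hsum, ?_⟩
  have e1 := ENNReal.tsum_toReal_eq hterm
  simp only [toReal_term_eq] at e1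
  rw [← e1, Torus.eGradNormSq_eq_tsum, ENNReal.toReal_mul, ENNReal.toReal_ofReal (by positivity : (0:ℝ) ≤ 4 * Real.pi ^ 2)]
  field_simp

/-- **The dissipation density of a weak tensor solution is a.e. finite** when the time integral is. -/
theorem ae_eGradNormSq_ne_top {A T : ℝ} {𝔸 : Visc4 d} {b w : ℝ → UnitAddTorus d → EuclideanSpace ℝ d}
    {w₀ : UnitAddTorus d → EuclideanSpace ℝ d} (h : Torus.IsWeakTensorPassiveVectorOn A T 𝔸 b w₀ w)
    (hfin : ∫⁻ s in Ioo 0 T, Torus.eGradNormSq (w s) < ⊤) :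
    ∀ᵐ s ∂(volume.restrict (Ioo 0 T)), Torus.eGradNormSq (w s) ≠ ⊤ :=
  (ae_lt_top' h.aemeasurable_eGradNormSq' hfin.ne).mono fun _ hs => hs.ne

/-- **Time-integrability of the dissipation density** `s ↦ (eGradNormSq (w s)).toReal` on `(0,T)`. -/
theorem integrableOn_toReal_eGradNormSq {A T : ℝ} {𝔸 : Visc4 d} {b w : ℝ → UnitAddTorus d → EuclideanSpace ℝ d}
    {w₀ : UnitAddTorus d → EuclideanSpace ℝ d} (h : Torus.IsWeakTensorPassiveVectorOn A T 𝔸 b w₀ w)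
    (hfin : ∫⁻ s in Ioo 0 T, Torus.eGradNormSq (w s) < ⊤) :
    IntegrableOn (fun s => (Torus.eGradNormSq (w s)).toReal) (Ioo 0 T) ∧
      ∫ s in Ioo 0 T, (Torus.eGradNormSq (w s)).toReal = (∫⁻ s in Ioo 0 T, Torus.eGradNormSq (w s)).toReal := by
  refine ⟨integrable_toReal_of_lintegral_ne_top h.aemeasurable_eGradNormSq' hfin.ne, ?_⟩
  rw [integral_toReal h.aemeasurable_eGradNormSq' (ae_lt_top' h.aemeasurable_eGradNormSq' hfin.ne)]

end Summit.AnomalousDissipation.AnomalousDissipation.Theorems.SolenoidalFractalHomogenisation.LagrangianStep
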